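import Mathlib
import HarnessLib

/-!
# Route `SqueezeCycle`, support `SignLaw` (item stmt-NavierStokesRegularity-11612) — Betchov's
# middle-eigenvalue sign law `ω·Sω = 4 det ∇u − 4 det S`

For a real `3 × 3` matrix `A` (the velocity gradient, `A i j = ∂ⱼ uᵢ`) with vorticity vector
`ω = (A₂₁ − A₁₂, A₀₂ − A₂₀, A₁₀ − A₀₁)` (`= curl u`) and strain `S = ½ (A + Aᵀ)`, the pointwise
identity `ω · S ω = 4 det A − 4 det S` holds (Betchov 1956; it is the `3 × 3` polynomial identity
behind `tr A³ = tr S³ + ¾ ω·Sω` and Cayley–Hamilton `tr A³ = 3 det A` on `sl(3, ℝ)`). The identity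
is in fact valid for every real `3 × 3` matrix; the route states it for trace-free `A`, and we prove
exactly the route's statement (the trace hypothesis is not used and is cleared). The statement is
the Prop of `Summit.NavierStokesRegularity.NavierStokesRegularity.Theses.SqueezeCycle.SignLaw`,
restated verbatim so that this module does not import the route file.

References: R. Betchov, *An inequality concerning the production of vorticity in isotropic
turbulence*, J. Fluid Mech. 1 (1956) 497–504, doi:10.1017/S0022112056000317; E. Miller,
Arch. Ration. Mech. Anal. 2019 (doi:10.1007/s00205-019-01419-z), §1.
-/

namespace Summit.NavierStokesRegularity.NavierStokesRegularity.Theorems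

open scoped Matrix

/-- **Betchov's sign law** (route `SqueezeCycle`, item `SignLaw`, stmt-NavierStokesRegularity-11612):
for a trace-free real `3 × 3` matrix `A` with `ω = (A 2 1 - A 1 2, A 0 2 - A 2 0, A 1 0 - A 0 1)` and
`S = ½ (A + Aᵀ)`, `ω ⬝ᵥ (S *ᵥ ω) = 4 det A - 4 det S`. A polynomial identity in the nine entries
(`Matrix.det_fin_three` and `ring`); the trace hypothesis is not needed. -/
theorem signLaw_proof :
    ∀ A : Matrix (Fin 3) (Fin 3) ℝ, A.trace = 0 →
      ![A 2 1 - A 1 2, A 0 2 - A 2 0, A 1 0 - A 0 1] ⬝ᵥ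
          (((1 / 2 : ℝ) • (A + Aᵀ)) *ᵥ ![A 2 1 - A 1 2, A 0 2 - A 2 0, A 1 0 - A 0 1]) =
        4 * A.det - 4 * (((1 / 2 : ℝ) • (A + Aᵀ))).det := by
  intro A _
  simp only [Matrix.det_fin_three, Matrix.mulVec, dotProduct, Fin.sum_univ_three,
    Matrix.cons_val_zero, Matrix.cons_val_one, Matrix.cons_val_two, Matrix.head_cons,
    Matrix.tail_cons, Matrix.smul_apply, Matrix.add_apply, Matrix.transpose_apply, smul_eq_mul]
  ring

end Summit.NavierStokesRegularity.NavierStokesRegularity.Theorems
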